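import Summits.NavierStokesRegularity.NavierStokesRegularity.Theorems.PoloidalWindowDoorPoloidalWindowRigidityZShockVirialLaw
import Summits.NavierStokesRegularity.NavierStokesRegularity.Theorems.PoloidalWindowDoorPoloidalWindowRigidityZShockLocalEnergy
import HarnessLib

/-!
# Crux K2 `PoloidalWindowRigidity` (stmt-NavierStokesRegularity-19708), line `z_shock` — the virial law INTEGRATED over one height period
# against a horizontal cutoff: the periodic virial identity (first half of «no horizontally localised breathers»)

`--supports stmt-NavierStokesRegularity-19708 --as helper` (leafhand-ns-poloidalwindowdoor-3 g11, cell decomp-ns, 2026-08-31).  Def-free; tree files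
`…ZShockVirialLaw` (pointwise law, this seat) and `…ZShockLocalEnergy` (cone energy with a STATIC cutoff, speed `c = 0`).  **No stub and no summit
is closed by this file; Navier–Stokes regularity is NOT proved here (rung 0).**

WHY THIS FILE.  Among the candidate inhabitants of the autonomous hyperbolic column of R3 (card `Lines/z_shock.md`, §Instrument row: «separable /
radial / two-phase ansätze») the tree has killed plane and travelling waves (`…ZShockTravellingRigid`), radial profiles and — for the LINEAR column
only — exhibited rotating Bessel patterns (`…ZShockRotatingProfileLinearWitness`).  The next natural family is the BREATHER: a pattern periodic in the
height `s` and localised in the horizontal variable.  The virial law `∂ₛ[(y·u)(w − w⋆)] + div[(y·u)u − ½|u|²y − Θ(w)y] = −2Θ(w)` has a bulk term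
`≥ γlo (w − w⋆)²` under hyperbolicity alone, so a height-periodic pattern with finite horizontal energy must be horizontally frozen.  This file
proves the exact integrated identity from which that follows:

* `smooth_moment`, `smooth_flux`, `smooth_bulk` — joint smoothness of the virial densities of a jointly smooth pair `(u, w)`;
* `virial_balance` — the pointwise law in the balance-law format `∂ₛe + Σᵢ∂ᵢfᵢ = σ` of `…ZShockLocalEnergy.hasDerivAt_coneEnergy`;
* ★ `periodic_virial_identity` — for jointly smooth `(u, w)` obeying the autonomous height-evolution (`∂ₛuᵢ = G(w)∂ᵢw`, `∂ₛw = −div u`,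
  `∂₁u₀ = ∂₀u₁`) and `P`-PERIODIC in the height, and every cutoff radius `a`:

    `∫₀ᴾ ∫ χ_a(y)·(−2Θ(w)) dy ds = − ∫₀ᴾ ∫ χ_a'(⟨y⟩)⟨y⟩⁻¹ · Σᵢ yᵢ fᵢ dy ds`,

  `χ_a(y) = smoothTransition(a + 1 − ⟨y⟩)`, `⟨y⟩ = √(1+|y|²)`: the period-integrated signed bulk inside the ball of radius `a` is paid ENTIRELY by
  the flux moment `Σ yᵢfᵢ = (y·u)² − ½|u|²|y|² − Θ(w)|y|²` in the transition shell `a ≤ ⟨y⟩ ≤ a + 1` (the height-boundary terms cancel by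
  periodicity: `M_a(P) = M_a(0)` for the cut-off moment `M_a(s) = ∫ χ_a (y·u)(w − w⋆)`);
* `periodic_virial_le` — hence, on a hyperbolic column `−γhi ≤ G ≤ −γlo < 0` (with `Θ(w⋆) = 0`),
  `γlo ∫₀ᴾ ∫ χ_a (w − w⋆)² ≤ ∫₀ᴾ ∫ |χ_a'(⟨y⟩)|·⟨y⟩·(³⁄₂|u|² + (γhi/2)(w − w⋆)²)`: the localised height-periodic energy of `w − w⋆` inside radius `a`
  is bounded by the energy in the shell `a ≤ ⟨y⟩ ≤ a+1` times its radius — the quantitative form of «no localised breathers» (a pattern with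
  `sup_s ∫(|u|² + (w−w⋆)²) < ∞` has shells of energy `o(1/a)` along a subsequence, forcing `w ≡ w⋆`; that limiting step is NOT taken in this file).

Honest scope: M-sized bookkeeping over the two imported files; kinematic (no NS, no genuine nonlinearity); the LINEAR column satisfies the same
identity (consistent with Rellich: the Helmholtz equation has no `L²(ℝ²)` solutions), so the breather door does not separate THICK from (TH) — it
removes one inhabitant family from both.  presearch: as in `…ZShockVirialLaw` (Vuillermot / Coron breather non-existence for semilinear Klein–Gordon,
[corpus: book:knowles1987-differential-equations-mathematical-physics-proceedings pp.402–409]); nothing for quasilinear first-order systems in two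
space dimensions. [folklore]
-/

noncomputable section

namespace Summit.NavierStokesRegularity.NavierStokesRegularity.Theorems.PoloidalWindowDoorPoloidalWindowRigidityZShockPeriodicVirial

-- the summit and its single sub-problem share the name (CONVENTIONS §1)
set_option linter.dupNamespace false

open Set Filter Topology Function MeasureTheory Metric
open scoped ContDiff
open Literature.Analysis.FluidPDE (continuousOn_integral_of_support_subset)
open Summit.NavierStokesRegularity.NavierStokesRegularity.Theorems.PoloidalWindowDoorPoloidalWindowRigidityZShockVirialLaw
open Summit.NavierStokesRegularity.NavierStokesRegularity.Theorems.PoloidalWindowDoorPoloidalWindowRigidityZShockLocalEnergyCutoff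
open Summit.NavierStokesRegularity.NavierStokesRegularity.Theorems.PoloidalWindowDoorPoloidalWindowRigidityZShockLocalEnergy

variable {u : Fin 2 → ℝ → EuclideanSpace ℝ (Fin 2) → ℝ} {w : ℝ → EuclideanSpace ℝ (Fin 2) → ℝ} {G Θ : ℝ → ℝ} {wstar P : ℝ}

/-! ### Smoothness of the virial densities -/

/-- Coordinates of the horizontal variable are jointly smooth on `ℝ × ℝ²`. [folklore] -/
theorem contDiff_snd_coord (i : Fin 2) : ContDiff ℝ ∞ fun p : ℝ × EuclideanSpace ℝ (Fin 2) => p.2 i :=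
  (EuclideanSpace.proj (𝕜 := ℝ) i).contDiff.comp contDiff_snd

/-- The virial moment `(y·u)(w − w⋆)` is jointly smooth. [folklore] -/
theorem smooth_moment (hu : ∀ i, ContDiff ℝ ∞ (uncurry (u i))) (hw : ContDiff ℝ ∞ (uncurry w)) (wstar : ℝ) :
    ContDiff ℝ ∞ (uncurry fun s y => (y 0 * u 0 s y + y 1 * u 1 s y) * (w s y - wstar)) := by
  have h0 : ContDiff ℝ ∞ fun p : ℝ × EuclideanSpace ℝ (Fin 2) => p.2 0 * u 0 p.1 p.2 + p.2 1 * u 1 p.1 p.2 :=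
    ((contDiff_snd_coord 0).mul (hu 0)).add ((contDiff_snd_coord 1).mul (hu 1))
  exact h0.mul (hw.sub contDiff_const)

/-- The virial fluxes `(y·u)uᵢ − ½|u|²yᵢ − Θ(w)yᵢ` are jointly smooth. [folklore] -/
theorem smooth_flux (hu : ∀ i, ContDiff ℝ ∞ (uncurry (u i))) (hw : ContDiff ℝ ∞ (uncurry w)) (hΘ : ContDiff ℝ ∞ Θ)
    (i : Fin 2) :
    ContDiff ℝ ∞ (uncurry fun s y =>
      (y 0 * u 0 s y + y 1 * u 1 s y) * u i s y - (1 / 2) * (u 0 s y ^ 2 + u 1 s y ^ 2) * y i - Θ (w s y) * y i) := by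
  have h0 : ContDiff ℝ ∞ fun p : ℝ × EuclideanSpace ℝ (Fin 2) => p.2 0 * u 0 p.1 p.2 + p.2 1 * u 1 p.1 p.2 :=
    ((contDiff_snd_coord 0).mul (hu 0)).add ((contDiff_snd_coord 1).mul (hu 1))
  have h1 : ContDiff ℝ ∞ fun p : ℝ × EuclideanSpace ℝ (Fin 2) => (1 / 2 : ℝ) * (u 0 p.1 p.2 ^ 2 + u 1 p.1 p.2 ^ 2) :=
    contDiff_const.mul (((hu 0).pow 2).add ((hu 1).pow 2))
  have h2 : ContDiff ℝ ∞ fun p : ℝ × EuclideanSpace ℝ (Fin 2) => Θ (w p.1 p.2) := hΘ.comp hw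
  exact ((h0.mul (hu i)).sub (h1.mul (contDiff_snd_coord i))).sub (h2.mul (contDiff_snd_coord i))

/-- The virial bulk `−2Θ(w)` is jointly smooth. [folklore] -/
theorem smooth_bulk (hw : ContDiff ℝ ∞ (uncurry w)) (hΘ : ContDiff ℝ ∞ Θ) :
    ContDiff ℝ ∞ (uncurry fun s y => -2 * Θ (w s y)) :=
  contDiff_const.mul (hΘ.comp hw)

/-! ### The balance law -/

/-- **The virial law in balance-law format** (`∂ₛe + Σᵢ∂ᵢfᵢ = σ`), from `…ZShockVirialLaw.virialLaw_pointwise`. [folklore] -/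
theorem virial_balance (hu : ∀ i, ContDiff ℝ ∞ (uncurry (u i))) (hw : ContDiff ℝ ∞ (uncurry w))
    (hΘ : ∀ r, HasDerivAt Θ ((r - wstar) * G r) r)
    (hus : ∀ i s y, HasDerivAt (fun s' => u i s' y) (G (w s y) * fderiv ℝ (w s) y (EuclideanSpace.single i 1)) s)
    (hws : ∀ s y, HasDerivAt (fun s' => w s' y)
      (-(fderiv ℝ (u 0 s) y (EuclideanSpace.single 0 1) + fderiv ℝ (u 1 s) y (EuclideanSpace.single 1 1))) s)
    (hpol : ∀ s y, fderiv ℝ (u 0 s) y (EuclideanSpace.single 1 1) = fderiv ℝ (u 1 s) y (EuclideanSpace.single 0 1))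
    (s : ℝ) (y : EuclideanSpace ℝ (Fin 2)) :
    deriv (fun s' => (y 0 * u 0 s' y + y 1 * u 1 s' y) * (w s' y - wstar)) s +
      ∑ i : Fin 2, fderiv ℝ (fun y' : EuclideanSpace ℝ (Fin 2) =>
          (y' 0 * u 0 s y' + y' 1 * u 1 s y') * u i s y' - (1 / 2) * (u 0 s y' ^ 2 + u 1 s y' ^ 2) * y' i
            - Θ (w s y') * y' i) y (EuclideanSpace.single i 1)
      = -2 * Θ (w s y) :=
  virialLaw_pointwise (fun i => ((contDiff_slice (hu i) s).differentiable (by simp)).differentiableAt)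
    ((contDiff_slice hw s).differentiable (by simp)).differentiableAt (hΘ _) (fun i => hus i s y) (hws s y) (hpol s y)

/-! ### The periodic virial identity -/

/-- ★ **The periodic virial identity.**  For a jointly smooth pair `(u, w)` obeying the autonomous height-evolution and `P`-periodic in the
height, and every cutoff radius `a`: the period-integrated cut-off bulk equals minus the period-integrated flux moment in the transition shell,

  `∫₀ᴾ ∫ χ_a (−2Θ(w)) dy ds = −∫₀ᴾ ∫ χ_a'(⟨y⟩)⟨y⟩⁻¹ (Σᵢ yᵢ fᵢ) dy ds`

(written with the tree's moving cutoff at speed `c = 0`). [folklore] -/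
theorem periodic_virial_identity (hu : ∀ i, ContDiff ℝ ∞ (uncurry (u i))) (hw : ContDiff ℝ ∞ (uncurry w))
    (hΘs : ContDiff ℝ ∞ Θ) (hΘ : ∀ r, HasDerivAt Θ ((r - wstar) * G r) r)
    (hus : ∀ i s y, HasDerivAt (fun s' => u i s' y) (G (w s y) * fderiv ℝ (w s) y (EuclideanSpace.single i 1)) s)
    (hws : ∀ s y, HasDerivAt (fun s' => w s' y)
      (-(fderiv ℝ (u 0 s) y (EuclideanSpace.single 0 1) + fderiv ℝ (u 1 s) y (EuclideanSpace.single 1 1))) s)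
    (hpol : ∀ s y, fderiv ℝ (u 0 s) y (EuclideanSpace.single 1 1) = fderiv ℝ (u 1 s) y (EuclideanSpace.single 0 1))
    (hPu : ∀ i s y, u i (s + P) y = u i s y) (hPw : ∀ s y, w (s + P) y = w s y) (a : ℝ) :
    ∫ s in (0 : ℝ)..P, ∫ y : EuclideanSpace ℝ (Fin 2),
        Real.smoothTransition (a + 1 - (√(1 + ‖y‖ ^ 2) + 0 * s)) * (-2 * Θ (w s y)) =
      -∫ s in (0 : ℝ)..P, ∫ y : EuclideanSpace ℝ (Fin 2),
        deriv (fun v : ℝ => Real.smoothTransition (a + 1 - v)) (√(1 + ‖y‖ ^ 2) + 0 * s) / √(1 + ‖y‖ ^ 2) *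
          (0 * √(1 + ‖y‖ ^ 2) * ((y 0 * u 0 s y + y 1 * u 1 s y) * (w s y - wstar)) +
            ∑ i : Fin 2, y i * ((y 0 * u 0 s y + y 1 * u 1 s y) * u i s y
              - (1 / 2) * (u 0 s y ^ 2 + u 1 s y ^ 2) * y i - Θ (w s y) * y i)) := by
  -- the densities
  set e : ℝ → EuclideanSpace ℝ (Fin 2) → ℝ := fun s y => (y 0 * u 0 s y + y 1 * u 1 s y) * (w s y - wstar) with he_def
  set f : Fin 2 → ℝ → EuclideanSpace ℝ (Fin 2) → ℝ := fun i s y =>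
    (y 0 * u 0 s y + y 1 * u 1 s y) * u i s y - (1 / 2) * (u 0 s y ^ 2 + u 1 s y ^ 2) * y i - Θ (w s y) * y i with hf_def
  set σ : ℝ → EuclideanSpace ℝ (Fin 2) → ℝ := fun s y => -2 * Θ (w s y) with hσ_def
  have he : ContDiff ℝ ∞ (uncurry e) := smooth_moment hu hw wstar
  have hf : ∀ i, ContDiff ℝ ∞ (uncurry (f i)) := fun i => smooth_flux hu hw hΘs i
  have hσ : ContDiff ℝ ∞ (uncurry σ) := smooth_bulk hw hΘs
  have hbal : ∀ s y, deriv (fun s' => e s' y) s + ∑ i, fderiv ℝ (f i s) y (EuclideanSpace.single i 1) = σ s y :=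
    fun s y => virial_balance hu hw hΘ hus hws hpol s y
  -- the cut-off moment and its height derivative
  set M : ℝ → ℝ := fun s' => ∫ y : EuclideanSpace ℝ (Fin 2),
    Real.smoothTransition (a + 1 - (√(1 + ‖y‖ ^ 2) + 0 * s')) * e s' y with hM_def
  set T : ℝ → ℝ := fun s => ∫ y : EuclideanSpace ℝ (Fin 2),
    deriv (fun v : ℝ => Real.smoothTransition (a + 1 - v)) (√(1 + ‖y‖ ^ 2) + 0 * s) / √(1 + ‖y‖ ^ 2) *
      (0 * √(1 + ‖y‖ ^ 2) * e s y + ∑ i, y i * f i s y) with hT_def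
  set S : ℝ → ℝ := fun s => ∫ y : EuclideanSpace ℝ (Fin 2),
    Real.smoothTransition (a + 1 - (√(1 + ‖y‖ ^ 2) + 0 * s)) * σ s y with hS_def
  have hMd : ∀ s, HasDerivAt M (T s + S s) s := fun s => hasDerivAt_coneEnergy he hf hσ hbal a 0 s
  -- continuity of the derivative (parametric integrals of jointly continuous, uniformly compactly supported integrands)
  have hK : IsCompact (closedBall (0 : EuclideanSpace ℝ (Fin 2)) (a + 1)) := isCompact_closedBall _ _
  have hout : ∀ s : ℝ, ∀ y ∉ closedBall (0 : EuclideanSpace ℝ (Fin 2)) (a + 1), a + 1 - 0 * s < ‖y‖ := by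
    intro s y hy
    rw [mem_closedBall, dist_zero_right, not_le] at hy
    simpa using hy
  have hbr : ContDiff ℝ ∞ fun p : ℝ × EuclideanSpace ℝ (Fin 2) => √(1 + ‖p.2‖ ^ 2) + 0 * p.1 :=
    (contDiff_bracket.comp contDiff_snd).add (contDiff_const.mul contDiff_fst)
  have hTc : Continuous T := by
    have hΦ : Continuous fun p : ℝ × EuclideanSpace ℝ (Fin 2) =>
        deriv (fun v : ℝ => Real.smoothTransition (a + 1 - v)) (√(1 + ‖p.2‖ ^ 2) + 0 * p.1) / √(1 + ‖p.2‖ ^ 2) *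
          (0 * √(1 + ‖p.2‖ ^ 2) * e p.1 p.2 + ∑ i, p.2 i * f i p.1 p.2) := by
      refine ((((contDiff_profile (a + 1) (k := ⊤)).continuous_deriv (by simp)).comp hbr.continuous).div
        (contDiff_bracket.comp contDiff_snd (n := (⊤ : ℕ∞))).continuous fun p => (bracket_pos p.2).ne').mul ?_
      refine ((continuous_const.mul (contDiff_bracket.comp contDiff_snd (n := (⊤ : ℕ∞))).continuous).mul
        he.continuous).add ?_
      refine continuous_finsetSum _ fun i _ => (contDiff_snd_coord i).continuous.mul (hf i).continuous
    have h := continuousOn_integral_of_support_subset (μ := (volume : Measure (EuclideanSpace ℝ (Fin 2))))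
      (S := univ) (Φ := fun s (y : EuclideanSpace ℝ (Fin 2)) =>
        deriv (fun v : ℝ => Real.smoothTransition (a + 1 - v)) (√(1 + ‖y‖ ^ 2) + 0 * s) / √(1 + ‖y‖ ^ 2) *
          (0 * √(1 + ‖y‖ ^ 2) * e s y + ∑ i, y i * f i s y)) hK hΦ.continuousOn (fun s _ y hy => by
        show deriv (fun v : ℝ => Real.smoothTransition (a + 1 - v)) (√(1 + ‖y‖ ^ 2) + 0 * s) / √(1 + ‖y‖ ^ 2) *
          (0 * √(1 + ‖y‖ ^ 2) * e s y + ∑ i, y i * f i s y) = 0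
        rw [deriv_cutoff_eq_zero (hout s y hy)]; simp)
    exact continuousOn_univ.1 h
  have hSc : Continuous S := by
    have hΦ : Continuous fun p : ℝ × EuclideanSpace ℝ (Fin 2) =>
        Real.smoothTransition (a + 1 - (√(1 + ‖p.2‖ ^ 2) + 0 * p.1)) * σ p.1 p.2 :=
      (contDiff_cutoff_uncurry a 0 (n := 2)).continuous.mul hσ.continuous
    have h := continuousOn_integral_of_support_subset (μ := (volume : Measure (EuclideanSpace ℝ (Fin 2))))
      (S := univ) (Φ := fun s (y : EuclideanSpace ℝ (Fin 2)) =>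
        Real.smoothTransition (a + 1 - (√(1 + ‖y‖ ^ 2) + 0 * s)) * σ s y) hK hΦ.continuousOn (fun s _ y hy => by
        show Real.smoothTransition (a + 1 - (√(1 + ‖y‖ ^ 2) + 0 * s)) * σ s y = 0
        rw [cutoff_eq_zero (hout s y hy), zero_mul])
    exact continuousOn_univ.1 h
  -- periodicity of the cut-off moment
  have hMP : M P = M 0 := by
    simp only [hM_def]
    refine integral_congr_ae (Eventually.of_forall fun y => ?_)
    have h0 := hPu 0 0 y
    have h1 := hPu 1 0 y
    have h2 := hPw 0 y
    simp only [zero_add] at h0 h1 h2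
    simp only [he_def, h0, h1, h2, mul_zero, zero_mul, add_zero]
  -- the fundamental theorem of calculus over one period
  have hFTC : ∫ s in (0 : ℝ)..P, (T s + S s) = M P - M 0 :=
    intervalIntegral.integral_eq_sub_of_hasDerivAt (fun s _ => hMd s) ((hTc.add hSc).intervalIntegrable _ _)
  rw [hMP, sub_self, intervalIntegral.integral_add (hTc.intervalIntegrable _ _) (hSc.intervalIntegrable _ _)] at hFTC
  have hST : ∫ s in (0 : ℝ)..P, S s = -∫ s in (0 : ℝ)..P, T s := by linarith
  simpa only [hS_def, hT_def, hσ_def, he_def, hf_def] using hST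

end Summit.NavierStokesRegularity.NavierStokesRegularity.Theorems.PoloidalWindowDoorPoloidalWindowRigidityZShockPeriodicVirial

end
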